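import Summits.ValiantsHypothesis.ValiantsHypothesis.Theorems.GeneratorObstructionsPerGenDegreeSuperQPMinimalDegree

/-!
# Route GeneratorObstructions — K1 `PerGenDegreeSuperQP` (stmt-ValiantsHypothesis-11654):
# generator types of an orbit closure are generator types of the AMBIENT covariant algebra
# (`γ_χ(Δ_n[f]) ≤ γ_χ(ℂ[Sym^n])`; K1 ⇒ late minimal generators of the covariants of `m`-ics)

Fifteenth support file of the line `per_side_atoms` (a calibration FROM ABOVE for the crux K1
itself, complementing the occurrence-monoid files). The quotient map
`ℂ[Sym^n ℂ^σ] ↠ ℂ[Δ_n[f]] = ℂ[Sym^n]/I(GL·f)` is a `GL`-equivariant ALGEBRA surjection out of a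
completely reducible module, so — exactly as in the generator-obstruction principle
(`…GenPrinciple`: `g ∈ Δ(f) ⇒ γ_χ(g) ≤ γ_χ(f)`) — highest-weight spaces surject
(`map_mk_highestWeightSpace_coordRep`, `…MinimalDegree`), the span of products of highest-weight
spaces of complementary nonzero weights surjects, and the number of minimal generators of type
`χ` can only drop:

* `gamma_orbitClosure_le_gamma_ambient` — for every form `f` on finitely many linearly ordered
  variables, `n ≠ 0` and every weight `χ`:
  `γ_χ(ℂ[Δ_n[f]]) ≤ γ_χ(ℂ[Sym^n ℂ^σ])`, the right-hand side being the number of minimal generators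
  of weight `χ` of the classical algebra of COVARIANTS (`U`-invariants) of `n`-ics in `|σ|`
  variables (Derksen–Makam 2020 Lemma 1.3: surjections preserve generating sets).
* `lateAmbientGenerators_of_perGenDegreeSuperQP` — hence K1 (`PerGenDegreeSuperQP`, the route decl
  verbatim as hypothesis) IMPLIES: for every `c` and infinitely many `m` the covariant algebra of
  `m`-ics in `m²` variables has a minimal generator of some weight `χ` of degree
  `-|χ|/m > 2^((log₂ m + c)^c)`. K1 is therefore at least as strong as a super-quasi-polynomial
  lower bound for the generation degree of `ℂ[Sym^m ℂ^{m²}]^U` along a subsequence of `m` — a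
  statement of classical invariant theory for which only (exponential) UPPER bounds are in print
  (Jordan/Weyl for binary forms; Popov, Derksen `β ≤ (3/8) dim V · σ²` in general) and no
  super-polynomial lower bound (Derksen–Makam's exponential lower bounds are for cubic forms ⊕ …
  and tensor actions, arXiv:1902.10773 Thm. 1.6–1.7). Not a kill, a calibration: any proof of
  K1 proves this first.

Honest framing: structural upper bound and a necessary condition; K1, `stub_atomLate` (`c ≥ 2`)
and `GenFlipThesis` remain OPEN; nothing here bears on VP versus VNP.
References: [DerksenMakam2020] Lemma 1.3; [BurgisserEtAl2011] §5.2; [Derksen2001] (degree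
bounds), background only.
-/

set_option linter.dupNamespace false

noncomputable section

namespace Summit.ValiantsHypothesis.ValiantsHypothesis.Theorems.GeneratorObstructions.PerGenDegreeSuperQP

open MvPolynomial
open Literature.NumberTheory.DiophantineGeometry Literature.Computability.AlgebraicComplexity
  Literature.Computability.Complexity
section General

/-- **Quotients by the decomposable part along a surjection** (the linear algebra of "generators
of a quotient are images of generators", in the shape used here): for a linear map `π`, a
finite-dimensional `Hf` and submodules `Df`, `Dg` with `π(Df) ≤ Dg`,
`dim π(Hf) ⧸ (π(Hf) ∩ Dg) ≤ dim Hf ⧸ (Hf ∩ Df)`. (Same argument as the tree's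
`GeneratorObstructionsGenPrinciple.finrank_quotient_comap_le_of_map_eq`, restated route-free.)
[cite: DerksenMakam2020, Lemma 1.3] -/
theorem finrank_map_quotient_comap_le {K V W : Type*} [Field K] [AddCommGroup V]
    [Module K V] [AddCommGroup W] [Module K W] (π : V →ₗ[K] W) (Hf Df : Submodule K V)
    (Dg : Submodule K W) (hD : Df.map π ≤ Dg) [FiniteDimensional K Hf] :
    Module.finrank K (↥(Hf.map π) ⧸ Dg.comap (Hf.map π).subtype) ≤
      Module.finrank K (↥Hf ⧸ Df.comap Hf.subtype) := by
  have hres : ∀ x ∈ Hf, π x ∈ Hf.map π := fun x hx => Submodule.mem_map_of_mem hx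
  have hle : Df.comap Hf.subtype ≤ (Dg.comap (Hf.map π).subtype).comap (π.restrict hres) := by
    intro x hx
    simp only [Submodule.mem_comap, Submodule.subtype_apply, LinearMap.coe_restrict_apply] at hx ⊢
    exact hD (Submodule.mem_map_of_mem hx)
  have hsurj : Function.Surjective
      ((Df.comap Hf.subtype).mapQ (Dg.comap (Hf.map π).subtype) (π.restrict hres) hle) := by
    intro z
    obtain ⟨y, rfl⟩ := Submodule.Quotient.mk_surjective _ z
    obtain ⟨x, hx, hxy⟩ := (Submodule.mem_map.mp y.2)
    refine ⟨Submodule.Quotient.mk ⟨x, hx⟩, ?_⟩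
    rw [Submodule.mapQ_apply]
    congr 1
    exact Subtype.ext hxy
  exact LinearMap.finrank_le_finrank_of_surjective hsurj

variable {σ : Type*} [Fintype σ] [LinearOrder σ]

/-- **The decomposable part of the ambient maps onto the decomposable part of the orbit closure**
under `ℂ[Sym^n] ↠ ℂ[Δ_n[f]]` (algebra map: products to products, suprema to suprema; highest-weight
spaces onto highest-weight spaces). [cite: DerksenMakam2020, Lemma 1.3] -/
theorem map_mk_decomposable (f : MvPolynomial σ ℂ) (n : ℕ) (χ : Weight σ) :
    (⨆ p : Weight σ × Weight σ, ⨆ (_ : p.1 + p.2 = χ ∧ p.1 ≠ 0 ∧ p.2 ≠ 0),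
        highestWeightSpace (coordRep σ ℂ n) p.1 * highestWeightSpace (coordRep σ ℂ n) p.2).map
        (Ideal.Quotient.mkₐ ℂ (orbitVanishingIdeal f n)).toLinearMap =
      ⨆ p : Weight σ × Weight σ, ⨆ (_ : p.1 + p.2 = χ ∧ p.1 ≠ 0 ∧ p.2 ≠ 0),
        highestWeightSpace (orbitCoordRep f n) p.1 * highestWeightSpace (orbitCoordRep f n) p.2 := by
  simp only [Submodule.map_iSup, Submodule.map_mul, map_mk_highestWeightSpace_coordRep]

/-- **`γ_χ(Δ_n[f]) ≤ γ_χ(ℂ[Sym^n])`**: for `n ≠ 0`, the number of minimal generators of weight `χ` of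
the algebra of highest-weight vectors of the orbit-closure coordinate ring `ℂ[Δ_n[f]]` is at most
that of the ambient covariant algebra `ℂ[Sym^n ℂ^σ]^U` (dimension of `HWV_χ` modulo its
intersection with the span of products of highest-weight spaces of complementary nonzero
weights, on both sides). Generators of a quotient algebra are images of generators.
[cite: DerksenMakam2020, Lemma 1.3] -/
theorem gamma_orbitClosure_le_gamma_ambient (f : MvPolynomial σ ℂ) {n : ℕ} (hn : n ≠ 0)
    (χ : Weight σ) :
    Module.finrank ℂ (↥(highestWeightSpace (orbitCoordRep f n) χ) ⧸
        Submodule.comap (highestWeightSpace (orbitCoordRep f n) χ).subtype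
          (⨆ p : Weight σ × Weight σ, ⨆ (_ : p.1 + p.2 = χ ∧ p.1 ≠ 0 ∧ p.2 ≠ 0),
            highestWeightSpace (orbitCoordRep f n) p.1 * highestWeightSpace (orbitCoordRep f n) p.2)) ≤
      Module.finrank ℂ (↥(highestWeightSpace (coordRep σ ℂ n) χ) ⧸
        Submodule.comap (highestWeightSpace (coordRep σ ℂ n) χ).subtype
          (⨆ p : Weight σ × Weight σ, ⨆ (_ : p.1 + p.2 = χ ∧ p.1 ≠ 0 ∧ p.2 ≠ 0),
            highestWeightSpace (coordRep σ ℂ n) p.1 * highestWeightSpace (coordRep σ ℂ n) p.2)) := by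
  haveI : Infinite ℂ := CharZero.infinite ℂ
  haveI : FiniteDimensional ℂ (highestWeightSpace (coordRep σ ℂ n) χ) :=
    finiteDimensional_highestWeightSpace_coordRep_holds (k := ℂ) (σ := σ) hn χ
  have h := finrank_map_quotient_comap_le (Ideal.Quotient.mkₐ ℂ (orbitVanishingIdeal f n)).toLinearMap
    (highestWeightSpace (coordRep σ ℂ n) χ)
    (⨆ p : Weight σ × Weight σ, ⨆ (_ : p.1 + p.2 = χ ∧ p.1 ≠ 0 ∧ p.2 ≠ 0),
      highestWeightSpace (coordRep σ ℂ n) p.1 * highestWeightSpace (coordRep σ ℂ n) p.2)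
    _ (map_mk_decomposable f n χ).le
  rw [map_mk_highestWeightSpace_coordRep f n χ] at h
  exact h

end General

/-! ### K1 ⇒ late minimal generators of the covariants of `m`-ics in `m²` variables -/

/-- **A necessary condition for K1.** If `PerGenDegreeSuperQP` holds (the route decl verbatim),
then for every `c, m₀` some `m ≥ m₀` has a weight `χ` of `GL_{m²}` (lexicographic Borel on the
matrix variables) at which the AMBIENT covariant algebra `ℂ[Sym^m ℂ^{m²}]^U` has a minimal
generator (`γ_χ(ℂ[Sym^m]) ≠ 0`) of degree `-|χ|/m > 2^((log₂ m + c)^c)`: K1 is at least as strong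
as super-quasi-polynomial generation degree of the classical covariants of `m`-ics in `m²`
variables, along a subsequence. (The hypothesis is the body of the route decl
`Theses.GeneratorObstructions.PerGenDegreeSuperQP`, spelled out to keep this file route-free.)
[cite: DerksenMakam2020, Lemma 1.3] -/
theorem lateAmbientGenerators_of_perGenDegreeSuperQP
    (hK1 : ∀ c m₀ : ℕ, ∃ m : ℕ, m₀ ≤ m ∧ ∃ χ : Weight (MatIdx m),
      Module.finrank ℂ (↥(highestWeightSpace (orbitCoordRep (MvPolynomial.rename toLex (perPoly (Fin m) ℂ)) m) χ) ⧸
        Submodule.comap (highestWeightSpace (orbitCoordRep (MvPolynomial.rename toLex (perPoly (Fin m) ℂ)) m) χ).subtype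
          (⨆ p : Weight (MatIdx m) × Weight (MatIdx m), ⨆ (_ : p.1 + p.2 = χ ∧ p.1 ≠ 0 ∧ p.2 ≠ 0),
            highestWeightSpace (orbitCoordRep (MvPolynomial.rename toLex (perPoly (Fin m) ℂ)) m) p.1 *
              highestWeightSpace (orbitCoordRep (MvPolynomial.rename toLex (perPoly (Fin m) ℂ)) m) p.2)) ≠ 0 ∧
      (m : ℤ) * 2 ^ ((Nat.log 2 m + c) ^ c) < -(Weight.size χ)) :
    ∀ c m₀ : ℕ, ∃ m : ℕ, m₀ ≤ m ∧ ∃ χ : Weight (MatIdx m),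
      Module.finrank ℂ (↥(highestWeightSpace (coordRep (MatIdx m) ℂ m) χ) ⧸
        Submodule.comap (highestWeightSpace (coordRep (MatIdx m) ℂ m) χ).subtype
          (⨆ p : Weight (MatIdx m) × Weight (MatIdx m), ⨆ (_ : p.1 + p.2 = χ ∧ p.1 ≠ 0 ∧ p.2 ≠ 0),
            highestWeightSpace (coordRep (MatIdx m) ℂ m) p.1 *
              highestWeightSpace (coordRep (MatIdx m) ℂ m) p.2)) ≠ 0 ∧
      (m : ℤ) * 2 ^ ((Nat.log 2 m + c) ^ c) < -(Weight.size χ) := by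
  intro c m₀
  obtain ⟨m, hm, χ, hγ, hdeg⟩ := hK1 c (max m₀ 1)
  have hm1 : m ≠ 0 := by have := le_max_right m₀ 1; omega
  refine ⟨m, (le_max_left m₀ 1).trans hm, χ, ?_, hdeg⟩
  intro h0
  exact hγ (Nat.eq_zero_of_le_zero
    (h0 ▸ gamma_orbitClosure_le_gamma_ambient (MvPolynomial.rename toLex (perPoly (Fin m) ℂ)) hm1 χ))

end Summit.ValiantsHypothesis.ValiantsHypothesis.Theorems.GeneratorObstructions.PerGenDegreeSuperQP

end
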